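import Literature.NumberTheory.EllipticCurves.RealLatticePeriodDiscrProofs
import Mathlib.Analysis.Calculus.Deriv.Inverse
import Mathlib.Topology.Order.MonotoneContinuity
import HarnessLib

/-!
# The inverse of `℘` on the real half-period of a real lattice

Helper file for the support item `EllipticAreaIdentity` of route `MultivaluedCoV`
(`Summits/KontsevichZagierPeriods/KontsevichZagierPeriods/Theses/MultivaluedCoV.lean`).

For a real lattice `Λ` (Mathlib `PeriodPair` `L`, `L.IsReal`) with least positive real period
`Ω₀` and `e₁ = ℘(Ω₀/2)`, the function `t ↦ ℘(t)` decreases strictly from `+∞` to `e₁` on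
`(0, Ω₀/2]` (tree: `PeriodPair.IsReal.strictAntiOn_weierstrassPRe`,
`PeriodPair.IsReal.image_weierstrassPRe_Ioo`; Lawden, *Elliptic Functions and Applications*,
§6.11). We package its inverse `a : (e₁, ∞) → (0, Ω₀/2)` ("`u = ℘⁻¹(x)` on the real segment")
as an existence statement (`exists_inverse_weierstrassPRe`, no new definition): `a` takes values in
`(0, Ω₀/2)`, `℘(a(x)) = x`, `a(℘(t)) = t`, and
`a'(x) = 1/℘'(a(x)) = −1/√(4x³ − g₂x − g₃)` (`℘'² = 4℘³ − g₂℘ − g₃`, `℘' < 0` on `(0, Ω₀/2)`),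
i.e. `du = −dx/√f(x)` — the substitution behind `∫_{e₁}^∞ dx/√f = Ω₀/2` (Lawden (6.12.4)).

## References
* D. F. Lawden, *Elliptic Functions and Applications*, Springer 1989, §§6.11–6.12.
-/

noncomputable section

open scoped Topology PeriodPair
open Complex Set Filter

namespace Summit.KontsevichZagierPeriods.MultivaluedCoV.EllipticArea

variable {L : PeriodPair}

/-- On `(0, Ω₀/2)`, `℘' = −√(4℘³ − g₂℘ − g₃)` for a real lattice (`℘'² = f(℘)`, `℘' < 0`). -/
theorem derivWeierstrassPRe_eq_neg_sqrt (h : L.IsReal) {t : ℝ} (ht0 : 0 < t)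
    (ht1 : t < L.minRealPeriod / 2) :
    L.derivWeierstrassPRe t =
      -Real.sqrt (4 * L.weierstrassPRe t ^ 3 - L.g₂.re * L.weierstrassPRe t - L.g₃.re) := by
  have hΩ := h.minRealPeriod_pos
  have hnot : (t : ℂ) ∉ L.lattice := h.ofReal_notMem_lattice ht0 (by linarith)
  rw [← h.derivWeierstrassPRe_sq hnot, Real.sqrt_sq_eq_abs,
    abs_of_neg (h.derivWeierstrassPRe_neg ht0 ht1), neg_neg]

/-- **The inverse of `℘` on the real half-period.** For a real lattice with `e₁ = ℘(Ω₀/2)` there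
is `a : ℝ → ℝ` with, for every `x > e₁`: `a x ∈ (0, Ω₀/2)`, `℘(a x) = x`, and
`a'(x) = −(√(4x³ − g₂x − g₃))⁻¹`; moreover `a(℘ t) = t` for `t ∈ (0, Ω₀/2)`.
(Lawden §6.11–6.12: `u = ∫_x^∞ dx/√f`, `x = ℘(u)`.) -/
theorem exists_inverse_weierstrassPRe (h : L.IsReal) :
    ∃ a : ℝ → ℝ,
      (∀ x, L.weierstrassPRe (L.minRealPeriod / 2) < x →
        a x ∈ Ioo 0 (L.minRealPeriod / 2) ∧ L.weierstrassPRe (a x) = x) ∧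
      (∀ t ∈ Ioo 0 (L.minRealPeriod / 2), a (L.weierstrassPRe t) = t) ∧
      (∀ x, L.weierstrassPRe (L.minRealPeriod / 2) < x →
        HasDerivAt a (-(Real.sqrt (4 * x ^ 3 - L.g₂.re * x - L.g₃.re))⁻¹) x) := by
  set Ω := L.minRealPeriod with hΩdef
  set p := L.weierstrassPRe with hp
  set e₁ := p (Ω / 2) with he₁
  set S : Set ℝ := Ioo 0 (Ω / 2) with hS
  have hΩ : 0 < Ω := h.minRealPeriod_pos
  have hanti : StrictAntiOn p (Ioc 0 (Ω / 2)) := h.strictAntiOn_weierstrassPRe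
  have hinj : InjOn p S := hanti.injOn.mono Ioo_subset_Ioc_self
  have himage : p '' S = Ioi e₁ := h.image_weierstrassPRe_Ioo
  set a : ℝ → ℝ := Function.invFunOn p S with ha
  have hex : ∀ x, e₁ < x → ∃ t ∈ S, p t = x := fun x hx => by
    have : x ∈ p '' S := by rw [himage]; exact hx
    exact this
  have h1 : ∀ x, e₁ < x → a x ∈ S ∧ p (a x) = x := fun x hx =>
    Function.invFunOn_pos (hex x hx)
  have h2 : ∀ t ∈ S, a (p t) = t := fun t ht => hinj.leftInvOn_invFunOn ht
  -- `a` is strictly decreasing on `(e₁, ∞)`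
  have hmono : StrictMonoOn (fun x => -a x) (Ioi e₁) := by
    intro x hx y hy hxy
    simp only [neg_lt_neg_iff]
    by_contra hle
    push Not at hle
    have hax := h1 x hx
    have hay := h1 y hy
    have : p (a y) ≤ p (a x) := hanti.antitoneOn (Ioo_subset_Ioc_self hax.1)
      (Ioo_subset_Ioc_self hay.1) hle
    rw [hax.2, hay.2] at this
    exact absurd hxy (not_lt.mpr this)
  -- hence continuous there
  have hcont : ∀ x, e₁ < x → ContinuousAt a x := by
    intro x hx
    have hax := h1 x hx
    have hc : ContinuousAt (fun x => -a x) x := by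
      refine hmono.continuousAt_of_image_mem_nhds (Ioi_mem_nhds hx) ?_
      have hsub : Ioo (-(Ω / 2)) 0 ⊆ (fun x => -a x) '' Ioi e₁ := by
        intro u hu
        have htS : -u ∈ S := ⟨by linarith [hu.2], by linarith [hu.1]⟩
        refine ⟨p (-u), ?_, ?_⟩
        · have : p (-u) ∈ p '' S := ⟨-u, htS, rfl⟩
          rw [himage] at this
          exact this
        · simp only [h2 (-u) htS, neg_neg]
      exact mem_of_superset (Ioo_mem_nhds (by linarith [hax.1.2]) (by linarith [hax.1.1])) hsub
    have h3 : a = fun y => -(-a y) := by funext y; simp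
    rw [h3]
    exact hc.neg
  refine ⟨a, h1, h2, fun x hx => ?_⟩
  have hax := h1 x hx
  have hnot : ((a x : ℝ) : ℂ) ∉ L.lattice := h.ofReal_notMem_lattice hax.1.1 (by linarith [hax.1.2])
  have hder : HasDerivAt p (L.derivWeierstrassPRe (a x)) (a x) :=
    PeriodPair.hasDerivAt_weierstrassPRe hnot
  have hne : L.derivWeierstrassPRe (a x) ≠ 0 := (h.derivWeierstrassPRe_neg hax.1.1 hax.1.2).ne
  have hev : ∀ᶠ y in 𝓝 x, p (a y) = y := by
    filter_upwards [Ioi_mem_nhds hx] with y hy using (h1 y hy).2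
  have hinv := hder.of_local_left_inverse (hcont x hx) hne hev
  have hpa : L.weierstrassPRe (a x) = x := hax.2
  rw [derivWeierstrassPRe_eq_neg_sqrt h hax.1.1 hax.1.2, hpa] at hinv
  simpa [inv_neg] using hinv

/-- The inverse of `℘` on the real half-period, complex form: for `x > e₁ = ℘(Ω₀/2)`,
`℘(a x) = x` and `℘'(a x) = −√(4x³ − g₂x − g₃)` as complex numbers, `a x ∈ (0, Ω₀/2)`,
`a'(x) = −1/√(4x³ − g₂x − g₃)`, and `a(℘ t) = t` on `(0, Ω₀/2)`. -/
theorem exists_inverse_weierstrassP_real (h : L.IsReal) :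
    ∃ a : ℝ → ℝ,
      (∀ x, L.weierstrassPRe (L.minRealPeriod / 2) < x →
        a x ∈ Ioo 0 (L.minRealPeriod / 2) ∧ ℘[L] (a x) = x ∧
          ℘'[L] (a x) = -(Real.sqrt (4 * x ^ 3 - L.g₂.re * x - L.g₃.re) : ℝ)) ∧
      (∀ t ∈ Ioo 0 (L.minRealPeriod / 2), a ((℘[L] t).re) = t) ∧
      (∀ x, L.weierstrassPRe (L.minRealPeriod / 2) < x →
        HasDerivAt a (-(Real.sqrt (4 * x ^ 3 - L.g₂.re * x - L.g₃.re))⁻¹) x) := by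
  obtain ⟨a, h1, h2, h3⟩ := exists_inverse_weierstrassPRe h
  refine ⟨a, fun x hx => ⟨(h1 x hx).1, ?_, ?_⟩, fun t ht => h2 t ht, h3⟩
  · rw [← h.ofReal_weierstrassPRe, (h1 x hx).2]
  · rw [← h.ofReal_derivWeierstrassPRe, derivWeierstrassPRe_eq_neg_sqrt h (h1 x hx).1.1
      (h1 x hx).1.2, (h1 x hx).2, Complex.ofReal_neg]

/-- **The inverse of `℘` on the imaginary half-period** of a real lattice `Λ`, through the rotated
real lattice `iΛ` (`℘_Λ(iu) = −℘_{iΛ}(u)`, `℘'_Λ(iu) = i℘'_{iΛ}(u)`, `g₂(iΛ) = g₂`,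
`g₃(iΛ) = −g₃`; Lawden (6.10.11)–(6.10.14)): with `Ω₀'` the least positive real period of `iΛ`
and `e₃ = ℘_Λ(iΩ₀'/2) = −℘_{iΛ}(Ω₀'/2)`, there is `c : ℝ → ℝ` with, for every `t < e₃`:
`c t ∈ (0, Ω₀'/2)`, `℘_Λ(i c t) = t`, `℘'_Λ(i c t) = −i√(−(4t³ − g₂t − g₃))` and
`c'(t) = 1/√(−(4t³ − g₂t − g₃))`; moreover `c(℘_Λ(iu)) = u` for `u ∈ (0, Ω₀'/2)`. -/
theorem exists_inverse_weierstrassP_imag (h : L.IsReal) :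
    ∃ c : ℝ → ℝ,
      (∀ t, t < -(L.mulLeft I I_ne_zero).weierstrassPRe
          ((L.mulLeft I I_ne_zero).minRealPeriod / 2) →
        c t ∈ Ioo 0 ((L.mulLeft I I_ne_zero).minRealPeriod / 2) ∧ ℘[L] (I * c t) = t ∧
          ℘'[L] (I * c t) = -I * (Real.sqrt (-(4 * t ^ 3 - L.g₂.re * t - L.g₃.re)) : ℝ)) ∧
      (∀ u ∈ Ioo 0 ((L.mulLeft I I_ne_zero).minRealPeriod / 2), c ((℘[L] (I * u)).re) = u) ∧
      (∀ t, t < -(L.mulLeft I I_ne_zero).weierstrassPRe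
          ((L.mulLeft I I_ne_zero).minRealPeriod / 2) →
        HasDerivAt c (Real.sqrt (-(4 * t ^ 3 - L.g₂.re * t - L.g₃.re)))⁻¹ t) := by
  set L' := L.mulLeft I I_ne_zero with hL'
  have h' : L'.IsReal := h.mulLeft_I
  have hg₂ : L'.g₂.re = L.g₂.re := by rw [hL', PeriodPair.g₂_mulLeft_I]
  have hg₃ : L'.g₃.re = -L.g₃.re := by rw [hL', PeriodPair.g₃_mulLeft_I, Complex.neg_re]
  obtain ⟨a, h1, h2, h3⟩ := exists_inverse_weierstrassP_real h'
  have hcubic : ∀ t : ℝ, 4 * (-t) ^ 3 - L'.g₂.re * (-t) - L'.g₃.re =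
      -(4 * t ^ 3 - L.g₂.re * t - L.g₃.re) := fun t => by rw [hg₂, hg₃]; ring
  refine ⟨fun t => a (-t), fun t ht => ?_, fun u hu => ?_, fun t ht => ?_⟩
  · have hlt : L'.weierstrassPRe (L'.minRealPeriod / 2) < -t := by linarith
    obtain ⟨hmem, hP, hP'⟩ := h1 (-t) hlt
    refine ⟨hmem, ?_, ?_⟩
    · rw [PeriodPair.weierstrassP_I_mul, ← hL', hP]
      push_cast
      ring
    · rw [PeriodPair.derivWeierstrassP_I_mul, ← hL', hP', hcubic]
      ring
  · have : (℘[L] (I * u)).re = -(℘[L'] u).re := by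
      rw [PeriodPair.weierstrassP_I_mul, ← hL', Complex.neg_re]
    simp only [this, neg_neg]
    exact h2 u hu
  · have hlt : L'.weierstrassPRe (L'.minRealPeriod / 2) < -t := by linarith
    have hd : HasDerivAt (fun s => a (-s))
        (-(Real.sqrt (4 * (-t) ^ 3 - L'.g₂.re * (-t) - L'.g₃.re))⁻¹ * -1) t :=
      (h3 (-t) hlt).comp t (hasDerivAt_neg t)
    rw [hcubic] at hd
    simpa using hd

end Summit.KontsevichZagierPeriods.MultivaluedCoV.EllipticArea

end
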